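import Summits.AtomisticToContinuum.FouriersLaw.Theorems.OddSectorIrreversibilityCorrectorTheory
import Summits.AtomisticToContinuum.FouriersLaw.Theorems.OddSectorIrreversibilityWitnessGlueKernels

/-!
# `TapLeakBound` (stmt-AtomisticToContinuum-15159), line `Sketch`: stub `stub_gaussIBP`

Helper file (`--supports` stmt-AtomisticToContinuum-15159) for the line `Sketch` of the crux
`OddSectorIrreversibility.TapLeakBound` (route `OddSectorIrreversibility`, sub-problem `FouriersLaw`).
It proves the registered stub `stub_gaussIBP`: the one-site Gaussian integration by parts against the
UNNORMALISED Gibbs weight `μ_T = e^{-H/T} dq dp` (`gibbsWeight ω₂ lam β γ N T`) of the pinned chain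
`P = pinnedChain ω₂ lam β γ` (`ω₂ > 0`, `lam, β ≥ 0`) at temperature `T > 0`. For `f, g ∈ C²` with
`∂_{p_b} f`, `𝒩_b f := -T ∂²_{p_b} f + p_b ∂_{p_b} f`, `g`, `∂_{p_b} g ∈ L²(μ_T)`:

  `T ∫ ∂_{p_b} f ∂_{p_b} g dμ_T = ∫ (𝒩_b f) g dμ_T`.

Proof. At energy-cutoff level `n` this is the tree's cutoff Dirichlet form `integral_chi_mul_bathOp`
with the site weights `[· = b]` (for which the thermostat operator is `S_B f = -𝒩_b f`):
`∫ χ_n (𝒩_b f) g ρ = T ∫ χ_n ∂_b f ∂_b g ρ + T ∫ ∂_bχ_n g ∂_b f ρ`, `ρ = e^{-H/T}`; then `n → ∞` by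
dominated convergence (`tendsto_integral_chi_mul`: `χ_n → 1`; `tendsto_integral_partialP_chi_mul`:
`∂χ_n → 0` boundedly), the three limiting integrands being in `L¹(e^{-H/T} dx)` as products of two
`L²(μ_T)` functions (`μ_T = Z • π_T` with `0 < Z < ∞`). References: Eckmann–Pillet–Rey-Bellet 1999 §3
(mechanism); folklore. Nothing here closes the item.
-/

noncomputable section

open MeasureTheory ProbabilityTheory Filter Topology Set Function
open scoped NNReal ENNReal ContDiff

namespace Summit.AtomisticToContinuum.FouriersLaw.Theorems.OddSectorIrreversibility.TapLeak

open Literature.MathematicalPhysics.KineticTheory.HeatConduction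
open Literature.MathematicalPhysics.KineticTheory
open Summit.AtomisticToContinuum.FouriersLaw.Theorems.OddSectorWitness
open Summit.AtomisticToContinuum.FouriersLaw.Theorems.SuperadditiveResistance.DeviceLiouville
open Summit.AtomisticToContinuum.FouriersLaw.Theorems.SuperadditiveResistance.Kubo
open Summit.AtomisticToContinuum.FouriersLaw.Theorems.OddSectorIrreversibility.Corrector

/-- `L²(μ_T) ⊆ L²(π_T)`: the Gibbs weight is `Z • π_T` with `0 < Z < ∞` (`π_T` the tilted probability
Gibbs measure). [folklore] -/
theorem gaussIBP_memLp_gibbsMeasure {ω₂ lam β : ℝ} (hω : 0 < ω₂) (hl : 0 ≤ lam) (hβ : 0 ≤ β) (γ : ℝ)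
    {N : ℕ} {T : ℝ} (hT : 0 < T) {F : PhaseSpace N → ℝ} (hF : MemLp F 2 (gibbsWeight ω₂ lam β γ N T)) :
    MemLp F 2 ((pinnedChain ω₂ lam β γ).gibbsMeasure N T) := by
  have hZ0 := (pinnedChain ω₂ lam β γ).partitionFunction_ne_zero (N := N) (T := T)
    (pinnedChain_continuous_gibbsDensity ω₂ lam β γ N T)
  have hZt := (pinnedChain ω₂ lam β γ).partitionFunction_ne_top
    (pinnedChain_integrable_gibbsDensity hω hl hβ γ N hT)
  have h := hF.smul_measure (ENNReal.inv_ne_top.2 hZ0)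
  rw [gibbsWeight_eq_smul_gibbsMeasure hω hl hβ hT, smul_smul, ENNReal.inv_mul_cancel hZ0 hZt,
    one_smul] at h
  exact h

/-- Integrals against the Gibbs weight are Lebesgue integrals with the density factor `e^{-H/T}`.
[folklore] -/
theorem gaussIBP_integral_gibbsWeight (ω₂ lam β γ : ℝ) (N : ℕ) (T : ℝ) (F : PhaseSpace N → ℝ) :
    ∫ x, F x ∂(gibbsWeight ω₂ lam β γ N T) = ∫ x, F x * (pinnedChain ω₂ lam β γ).gibbsDensity N T x :=
  integral_withDensity_gibbs (pinnedChain ω₂ lam β γ) (pinnedChain_contDiff_U ω₂ lam β γ (n := 0)).continuous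
    (pinnedChain_contDiff_V ω₂ lam β γ (n := 0)).continuous N T F

/-- **One-site Gaussian integration by parts, density form.** For the pinned chain, `T > 0`,
`f, g ∈ C²` with `∂_{p_b} f, 𝒩_b f, g, ∂_{p_b} g ∈ L²(π_T)` (`𝒩_b f = -T∂²_{p_b}f + p_b∂_{p_b}f`):
`T ∫ ∂_{p_b}f ∂_{p_b}g e^{-H/T} dx = ∫ (𝒩_b f) g e^{-H/T} dx` — the `n → ∞` limit of the cutoff
Dirichlet form `integral_chi_mul_bathOp` with site weights `[· = b]`. [folklore] -/
theorem gaussIBP_density {ω₂ lam β : ℝ} (hω : 0 < ω₂) (hl : 0 ≤ lam) (hβ : 0 ≤ β) (γ : ℝ) {T : ℝ}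
    (hT : 0 < T) {N : ℕ} (b : Fin N) {f g : PhaseSpace N → ℝ} (hf : ContDiff ℝ 2 f)
    (hg : ContDiff ℝ 2 g)
    (hdf : MemLp (partialP b f) 2 ((pinnedChain ω₂ lam β γ).gibbsMeasure N T))
    (hNf : MemLp (fun x => -(T * partialP b (partialP b f) x) + x.2 b * partialP b f x) 2
      ((pinnedChain ω₂ lam β γ).gibbsMeasure N T))
    (hg2 : MemLp g 2 ((pinnedChain ω₂ lam β γ).gibbsMeasure N T))
    (hdg : MemLp (partialP b g) 2 ((pinnedChain ω₂ lam β γ).gibbsMeasure N T)) :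
    T * ∫ x, partialP b f x * partialP b g x * (pinnedChain ω₂ lam β γ).gibbsDensity N T x =
      ∫ x, (-(T * partialP b (partialP b f) x) + x.2 b * partialP b f x) * g x *
        (pinnedChain ω₂ lam β γ).gibbsDensity N T x := by
  set P := pinnedChain ω₂ lam β γ with hP
  set ρ := P.gibbsDensity N T with hρ
  set Nf : PhaseSpace N → ℝ := fun x => -(T * partialP b (partialP b f) x) + x.2 b * partialP b f x
    with hNf_def
  set B : Fin N → ℝ := fun k => if k = b then 1 else 0 with hB
  -- continuity of the factors
  have hf1 : ContDiff ℝ 1 f := hf.of_le (by norm_cast)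
  have hg1 : ContDiff ℝ 1 g := hg.of_le (by norm_cast)
  have hgc : Continuous g := hg.continuous
  have hdfc : Continuous (partialP b f) := continuous_partialP hf1 one_ne_zero b
  have hdgc : Continuous (partialP b g) := continuous_partialP hg1 one_ne_zero b
  have hddf1 : ContDiff ℝ 1 (partialP b f) := contDiff_partialP hf (by norm_num) b
  have hddfc : Continuous (partialP b (partialP b f)) := continuous_partialP hddf1 one_ne_zero b
  have hNfc : Continuous Nf := by
    rw [hNf_def]
    fun_prop
  -- the site weights `[· = b]` pick out the site `b`, and `S_B f = -𝒩_b f`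
  have hS : ∀ a : Fin N → ℝ, ∑ i, B i * a i = a b := fun a => by
    simp only [hB, ite_mul, one_mul, zero_mul, Finset.sum_ite_eq', Finset.mem_univ, if_true]
  have hbath : ∀ x, bathOp N B T f x = -Nf x := fun x => by
    simp only [bathOp, hNf_def, hS]
    ring
  -- integrability of the three limiting integrands (products of two `L²(π_T)` functions)
  have hI1 : Integrable fun x => Nf x * g x * ρ x := integrable_mul_mul_gibbsDensity hω hl hβ γ N hT hNf hg2
  have hI2 : Integrable fun x => partialP b f x * partialP b g x * ρ x :=
    integrable_mul_mul_gibbsDensity hω hl hβ γ N hT hdf hdg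
  have hI3 : Integrable fun x => g x * partialP b f x * ρ x :=
    integrable_mul_mul_gibbsDensity hω hl hβ γ N hT hg2 hdf
  -- the level-`n` identity
  have hlevel : ∀ n : ℕ, ∫ x, chi P N n x * (Nf x * g x) * ρ x =
      T * (∫ x, chi P N n x * (partialP b f x * partialP b g x) * ρ x) +
        T * ∫ x, partialP b (chi P N n) x * (g x * partialP b f x) * ρ x := by
    intro n
    have hD := integral_chi_mul_bathOp hω hl hβ γ N B hT.ne' hg hf n
    have hL : ∫ x, chi P N n x * g x * bathOp N B T f x * ρ x = -∫ x, chi P N n x * (Nf x * g x) * ρ x := by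
      rw [← integral_neg]
      refine integral_congr_ae (Eventually.of_forall fun x => ?_)
      dsimp only
      rw [hbath x]
      ring
    have e1 : ∫ x, chi P N n x * partialP b g x * partialP b f x * ρ x =
        ∫ x, chi P N n x * (partialP b f x * partialP b g x) * ρ x :=
      integral_congr_ae (Eventually.of_forall fun x => by ring)
    have e2 : ∫ x, g x * partialP b (chi P N n) x * partialP b f x * ρ x =
        ∫ x, partialP b (chi P N n) x * (g x * partialP b f x) * ρ x :=
      integral_congr_ae (Eventually.of_forall fun x => by ring)
    rw [hS, hL, e1, e2] at hD
    linarith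
  -- the limits of both sides
  have hLim : Tendsto (fun n : ℕ => ∫ x, chi P N n x * (Nf x * g x) * ρ x) atTop
      (𝓝 (∫ x, Nf x * g x * ρ x)) :=
    tendsto_integral_chi_mul hω.le hl hβ γ N T (F := fun x => Nf x * g x)
      (hNfc.mul hgc).aestronglyMeasurable hI1
  have hR1 : Tendsto (fun n : ℕ => ∫ x, chi P N n x * (partialP b f x * partialP b g x) * ρ x) atTop
      (𝓝 (∫ x, partialP b f x * partialP b g x * ρ x)) :=
    tendsto_integral_chi_mul hω.le hl hβ γ N T (F := fun x => partialP b f x * partialP b g x)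
      (hdfc.mul hdgc).aestronglyMeasurable hI2
  have hR2 : Tendsto (fun n : ℕ => ∫ x, partialP b (chi P N n) x * (g x * partialP b f x) * ρ x) atTop
      (𝓝 0) :=
    tendsto_integral_partialP_chi_mul hω hl hβ γ N T b (F := fun x => g x * partialP b f x)
      (hgc.mul hdfc).aestronglyMeasurable hI3
  have hRim : Tendsto (fun n : ℕ => T * (∫ x, chi P N n x * (partialP b f x * partialP b g x) * ρ x) +
      T * ∫ x, partialP b (chi P N n) x * (g x * partialP b f x) * ρ x) atTop
      (𝓝 (T * (∫ x, partialP b f x * partialP b g x * ρ x) + T * 0)) :=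
    (hR1.const_mul T).add (hR2.const_mul T)
  have hlim := tendsto_nhds_unique (hLim.congr fun n => hlevel n) hRim
  rw [mul_zero, add_zero] at hlim
  exact hlim.symm

/-- STUB 2 of the line `Sketch` of crux `TapLeakBound` (fixed `N`, one-site Gaussian integration by
parts against the Gibbs weight). For the pinned chain `pinnedChain ω₂ lam β γ` (`ω₂ > 0`, `lam, β ≥ 0`),
`T > 0`, `f, g ∈ C²` with `∂_{p_b} f`, `𝒩_b f := -T∂²_{p_b}f + p_b∂_{p_b}f`, `g`, `∂_{p_b} g ∈ L²(μ_T)`,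
`μ_T = e^{-H/T} dq dp` the UNNORMALISED Gibbs weight:
`T ∫ ∂_{p_b}f ∂_{p_b}g dμ_T = ∫ (𝒩_b f) g dμ_T` (cutoff level: `integral_chi_mul_bathOp` with the
weight `[· = b]`; `n → ∞`: `tendsto_integral_chi_mul`, `tendsto_integral_partialP_chi_mul`). [folklore] -/
theorem stub_gaussIBP : ∀ {ω₂ lam β : ℝ}, 0 < ω₂ → 0 ≤ lam → 0 ≤ β → ∀ (γ : ℝ) {T : ℝ}, 0 < T →
    ∀ {N : ℕ} (b : Fin N) {f g : PhaseSpace N → ℝ}, ContDiff ℝ 2 f → ContDiff ℝ 2 g →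
    MemLp (partialP b f) 2 (gibbsWeight ω₂ lam β γ N T) →
    MemLp (fun x => -(T * partialP b (partialP b f) x) + x.2 b * partialP b f x) 2 (gibbsWeight ω₂ lam β γ N T) →
    MemLp g 2 (gibbsWeight ω₂ lam β γ N T) →
    MemLp (partialP b g) 2 (gibbsWeight ω₂ lam β γ N T) →
    T * ∫ x, partialP b f x * partialP b g x ∂(gibbsWeight ω₂ lam β γ N T) =
      ∫ x, (-(T * partialP b (partialP b f) x) + x.2 b * partialP b f x) * g x ∂(gibbsWeight ω₂ lam β γ N T) := by
  intro ω₂ lam β hω hl hβ γ T hT N b f g hf hg hdf hNf hg2 hdg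
  rw [gaussIBP_integral_gibbsWeight, gaussIBP_integral_gibbsWeight]
  exact gaussIBP_density hω hl hβ γ hT b hf hg (gaussIBP_memLp_gibbsMeasure hω hl hβ γ hT hdf)
    (gaussIBP_memLp_gibbsMeasure hω hl hβ γ hT hNf) (gaussIBP_memLp_gibbsMeasure hω hl hβ γ hT hg2)
    (gaussIBP_memLp_gibbsMeasure hω hl hβ γ hT hdg)

end Summit.AtomisticToContinuum.FouriersLaw.Theorems.OddSectorIrreversibility.TapLeak

end
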